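import Literature.Analysis.FluidPDE.PlanarNoAnomalousDissipation
import HarnessLib

/-!
# De Rosa–Park 2024: proved bookkeeping for `PlanarNoAnomalousDissipation.lean`

Companion (theorems only, no new facts) of `Literature/Analysis/FluidPDE/PlanarNoAnomalousDissipation.lean`
(L. De Rosa, J. Park, arXiv:2403.04668v3, Thm. 1.4, Thm. 5.1).

* `Torus.HasWeakPlanarCurl` API: the vorticity is integrable; the zero field has zero vorticity.
* `DeRosaPark2024.isStronglyPrecompactData_const`: a ν-independent `L²` datum satisfies (H1).
* `DeRosaPark2024.NoAnomalousDissipation.tendsto_seq`: no anomalous dissipation along every sequence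
  `νₙ → 0⁺` (the sequence form used by the tree's vanishing-viscosity families).
* Amendment 1: `Torus.HasWeakPlanarCurl.decomp_zero`, `DeRosaPark2024_thm14_T2_of_measure` (the
  vortex-sheet fact `DeRosaPark2024_thm14_T2_measure` implies the absolutely continuous one).
* `DeRosaPark2024_thm14_T2.of_fixedDatum`: **the fixed-datum case** — for ONE divergence-free datum
  `u₀ ∈ L²(T²)` whose vorticity `curl u₀` is an `L¹(T²)` function (in particular `ω₀ ∈ Lᵖ`, `p ≥ 1`,
  the range advertised on p. 3: "anomalous dissipation cannot occur … in the full range `p ≥ 1`"), the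
  Leray–Hopf solutions `u^ν` of the unforced 2D Navier–Stokes equations with datum `u₀` display no
  anomalous dissipation as `ν ↓ 0`. Derived from `DeRosaPark2024_thm14_T2` (constant families are
  strongly precompact and uniformly integrable, Mathlib's `uniformIntegrable_const`).

## References

* L. De Rosa, J. Park, arXiv:2403.04668v3 (2025), Thm. 1.4 pp. 3–4 and §1.2 p. 3. [`DeRosaPark2024`]
-/

open MeasureTheory Set Filter Topology Function Metric
open scoped ENNReal NNReal

namespace Literature.Analysis.FluidPDE

noncomputable section

open Literature.Analysis.FunctionSpaces

namespace Torus

/-- The weak planar curl is an integrable function (part of the definition). [cite: DeRosaPark2024, §1.1 p. 3] -/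
theorem HasWeakPlanarCurl.integrable {v : UnitAddTorus (Fin 2) → EuclideanSpace ℝ (Fin 2)}
    {ω : UnitAddTorus (Fin 2) → ℝ} (h : HasWeakPlanarCurl v ω) : Integrable ω volume :=
  h.1

/-- The defining identity of the weak planar curl: `∫ (∂₀χ·v₁ - ∂₁χ·v₀) = -∫ χ ω` for smooth `χ`. [cite: DeRosaPark2024, §1.1 p. 3] -/
theorem HasWeakPlanarCurl.integral_eq {v : UnitAddTorus (Fin 2) → EuclideanSpace ℝ (Fin 2)}
    {ω : UnitAddTorus (Fin 2) → ℝ} (h : HasWeakPlanarCurl v ω) {χ : UnitAddTorus (Fin 2) → ℝ}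
    (hχ : Torus.IsSmooth χ) :
    ∫ x, (Torus.partialDeriv 0 χ x * v x 1 - Torus.partialDeriv 1 χ x * v x 0) = -∫ x, χ x * ω x :=
  h.2 χ hχ

/-- The zero field has zero vorticity. [cite: DeRosaPark2024, §1.1 p. 3 (trivial instance)] -/
theorem hasWeakPlanarCurl_zero :
    HasWeakPlanarCurl (0 : UnitAddTorus (Fin 2) → EuclideanSpace ℝ (Fin 2)) 0 :=
  ⟨integrable_zero _ _ _, fun χ _ => by simp⟩

end Torus

namespace DeRosaPark2024

/-- **A `ν`-independent `L²` datum satisfies (H1)**: the constant family `ν ↦ u₀` is strongly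
precompact in `L²(T²)` (along any sequence it converges — it is constant). [cite: DeRosaPark2024, Thm. 1.4 (H1) p. 3 (trivial instance)] -/
theorem isStronglyPrecompactData_const {u₀ : UnitAddTorus (Fin 2) → EuclideanSpace ℝ (Fin 2)}
    (hu₀ : MemLp u₀ 2 volume) : IsStronglyPrecompactData fun _ => u₀ := by
  refine ⟨fun _ _ => hu₀, fun s _ => ⟨id, strictMono_id, u₀, hu₀, ?_⟩⟩
  simp

/-- **No anomalous dissipation along sequences**: if `ν∫₀ᵀ‖∇u^ν‖² → 0` as `ν ↓ 0`, then for every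
sequence of positive viscosities `νₙ → 0` the dissipations `νₙ∫₀ᵀ‖∇u^{νₙ}‖²` tend to `0`.
[cite: DeRosaPark2024, Thm. 1.4 (T2) p. 4] -/
theorem NoAnomalousDissipation.tendsto_seq {T : ℝ}
    {u : ℝ → ℝ → UnitAddTorus (Fin 2) → EuclideanSpace ℝ (Fin 2)} (h : NoAnomalousDissipation T u)
    {κ : ℕ → ℝ} (hpos : ∀ n, 0 < κ n) (hκ : Tendsto κ atTop (𝓝 0)) :
    Tendsto (fun n => ENNReal.ofReal (κ n) * ∫⁻ t in Ioo 0 T, Torus.eGradNormSq (u (κ n) t)) atTop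
      (𝓝 0) :=
  h.comp (tendsto_nhdsWithin_iff.2 ⟨hκ, Eventually.of_forall fun n => hpos n⟩)

end DeRosaPark2024

open DeRosaPark2024 in
/-- **De Rosa–Park, Thm. 1.4 (T2) for a fixed datum with `L¹` vorticity** ("anomalous dissipation
cannot occur … in the full range `p ≥ 1`", p. 3): from `DeRosaPark2024_thm14_T2`, if `T > 0` and
`u₀ ∈ L²(T²)` is weakly divergence free with an integrable weak curl `ω₀` (`Torus.HasWeakPlanarCurl u₀ ω₀`),
then every family `ν ↦ u ν` (`ν ∈ (0,1)`) of Leray–Hopf solutions of the unforced 2D Navier–Stokes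
equations with viscosity `ν` and the SAME datum `u₀` satisfies `ν∫₀ᵀ‖∇u^ν‖² → 0` as `ν ↓ 0`: the constant
data family is strongly precompact (`isStronglyPrecompactData_const`) and the constant vorticity family
is uniformly integrable (Mathlib `uniformIntegrable_const`). [cite: DeRosaPark2024, Thm. 1.4 pp. 3–4 and §1.2 p. 3] -/
theorem DeRosaPark2024_thm14_T2.of_fixedDatum (h : DeRosaPark2024_thm14_T2) {T : ℝ} (hT : 0 < T)
    {u₀ : UnitAddTorus (Fin 2) → EuclideanSpace ℝ (Fin 2)} {ω₀ : UnitAddTorus (Fin 2) → ℝ}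
    (hu₀ : MemLp u₀ 2 volume) (hdiv : Torus.IsWeaklyDivFree u₀) (hω₀ : Torus.HasWeakPlanarCurl u₀ ω₀)
    {u : ℝ → ℝ → UnitAddTorus (Fin 2) → EuclideanSpace ℝ (Fin 2)}
    (hu : ∀ ν ∈ Ioo (0 : ℝ) 1, Torus.IsLerayHopfOn T ν 0 u₀ (u ν)) :
    NoAnomalousDissipation T u :=
  h T (fun _ => u₀) (fun _ => ω₀) hT (fun _ _ => hdiv) (isStronglyPrecompactData_const hu₀)
    (fun _ _ => hω₀)
    (uniformIntegrable_const le_rfl ENNReal.one_ne_top (memLp_one_iff_integrable.2 hω₀.integrable))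
    u hu

/-! ### Amendment 1 (append-only): the measure-valued fact implies the absolutely continuous one -/

namespace Torus

/-- An `L¹` vorticity is a vorticity decomposition with zero singular part:
`HasWeakPlanarCurl v ω → HasWeakPlanarCurlDecomp v ω 0`. [cite: DeRosaPark2024, Thm. 1.4 (H2) p. 3] -/
theorem HasWeakPlanarCurl.decomp_zero {v : UnitAddTorus (Fin 2) → EuclideanSpace ℝ (Fin 2)}
    {ω : UnitAddTorus (Fin 2) → ℝ} (h : HasWeakPlanarCurl v ω) : HasWeakPlanarCurlDecomp v ω 0 := by
  refine ⟨h.1, inferInstance, fun χ hχ => ?_⟩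
  rw [h.2 χ hχ, integral_zero_measure, add_zero]

end Torus

/-- **The vortex-sheet form of Thm. 1.4 (T2) implies the absolutely continuous form**: taking
`Ω₀^ν = 0` in `DeRosaPark2024_thm14_T2_measure` gives `DeRosaPark2024_thm14_T2` (so the two landed facts
carry one piece of content). [cite: DeRosaPark2024, Thm. 1.4 pp. 3–4] -/
theorem DeRosaPark2024_thm14_T2_of_measure (h : DeRosaPark2024_thm14_T2_measure) :
    DeRosaPark2024_thm14_T2 := by
  intro T u₀ ω₀ hT hdiv hH1 hcurl hUI u hu
  refine h T u₀ ω₀ (fun _ => 0) hT hdiv hH1 (fun ν hν => (hcurl ν hν).decomp_zero) hUI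
    ⟨0, ENNReal.zero_lt_top, fun ν _ => ?_⟩ u hu
  simp

end

end Literature.Analysis.FluidPDE
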